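import Mathlib
import Summits.ValiantsHypothesis.ValiantsHypothesis.Theorems.SummationBitsDepth3ThesisStubBinomialGrowth

/-!
# Crux `Depth3Thesis` (stmt-ValiantsHypothesis-5934), line `registered` (rev 2) — stub `stub_midGrowth`

**Claim settled** (TRUE, pure `ℕ` arithmetic, no `n₀`): the arithmetic of the extended flattening
regime `2n < D ≤ n²/(4k)` of the birth line of `Depth3Thesis`. With the explicit order
`k := (c⌊√n⌋+c+1)(⌊log₂(n+2)⌋+1)`: if `2n < D` and `D · 4k ≤ n²` then
`(n+2)^(c⌊√n⌋+c) · binom(D,k) < binom(n,k)²`, so some order `k` beats the threshold.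

Proof (division free). Multiply through by `(k!)²`:
* `k! · binom(D,k) = D(D-1)⋯(D-k+1) ≤ D^k` and `k! ≤ k^k`, so
  `(k!)² · (n+2)^E · binom(D,k) ≤ (n+2)^E · (kD)^k` (`E := c⌊√n⌋+c`);
* `(n+2)^E < (n+2)^(E+1) < (2^(⌊log₂(n+2)⌋+1))^(E+1) = 2^k`;
* the hypotheses give `8kn < 4kD ≤ n²`, so `8k < n`, `8(n+1-k) > 7n` and
  `(n+1-k)² ≥ 49n²/64 ≥ 2kD`; hence `2^k (kD)^k = (2kD)^k ≤ ((n+1-k)²)^k = ((n+1-k)^k)²`;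
* `(n+1-k)^k ≤ n(n-1)⋯(n-k+1) = k! · binom(n,k)`.
Chaining, `(k!)² · (n+2)^E · binom(D,k) < (k!)² · binom(n,k)²`; cancel `(k!)²`.

Unconditional; the proof uses Mathlib only (`Nat.pow_sub_le_descFactorial`,
`Nat.descFactorial_le_pow`, `Nat.descFactorial_eq_factorial_mul_choose`, `Nat.factorial_le_pow`,
`Nat.lt_pow_succ_log_self`); the landed sibling stub file `…StubBinomialGrowth` (same namespace,
flattening regime `D ≤ 2n`) is imported so that the two arithmetic stubs live side by side.
-/

-- layout Summits/ValiantsHypothesis/ValiantsHypothesis forces the duplicated namespace component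
set_option linter.dupNamespace false

namespace Summit.ValiantsHypothesis.ValiantsHypothesis.Theorems.SummationBitsDepth3Thesis

/-! ### The core comparison (division free) -/

/-- The core comparison with an abstract order `k ≥ 1` and threshold `T < 2^k`:
if moreover `0 < D` and `2kD ≤ (n+1-k)²`, then `T · binom(D,k) < binom(n,k)²`
(multiply by `(k!)²`; `k!·binom(D,k) = D(D-1)⋯(D-k+1) ≤ D^k`, `k! ≤ k^k`, `T < 2^k`,
`(2kD)^k ≤ ((n+1-k)²)^k` and `(n+1-k)^k ≤ n(n-1)⋯(n-k+1) = k!·binom(n,k)`; cancel `(k!)²`). -/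
theorem mul_choose_lt_choose_sq (n D k T : ℕ) (hk : 1 ≤ k) (hD : 0 < D) (hT : T < 2 ^ k)
    (hsq : 2 * (k * D) ≤ (n + 1 - k) ^ 2) : T * D.choose k < (n.choose k) ^ 2 := by
  have hkD : 0 < (k * D) ^ k := Nat.pow_pos (Nat.mul_pos hk hD)
  -- `k! · binom(D,k) ≤ D^k` and `(n+1-k)^k ≤ k! · binom(n,k)` via the descending factorial
  have hup : k.factorial * D.choose k ≤ D ^ k := by
    rw [← Nat.descFactorial_eq_factorial_mul_choose]
    exact Nat.descFactorial_le_pow D k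
  have hlow : (n + 1 - k) ^ k ≤ k.factorial * n.choose k := by
    rw [← Nat.descFactorial_eq_factorial_mul_choose]
    exact Nat.pow_sub_le_descFactorial n k
  have key : k.factorial ^ 2 * (T * D.choose k) < k.factorial ^ 2 * (n.choose k) ^ 2 :=
    calc k.factorial ^ 2 * (T * D.choose k)
        = T * (k.factorial * (k.factorial * D.choose k)) := by ring
      _ ≤ T * (k ^ k * D ^ k) :=
          Nat.mul_le_mul_left _
            (Nat.mul_le_mul (Nat.factorial_le_pow k) hup)
      _ = T * (k * D) ^ k := by rw [mul_pow]
      _ < 2 ^ k * (k * D) ^ k := Nat.mul_lt_mul_of_pos_right hT hkD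
      _ = (2 * (k * D)) ^ k := (mul_pow _ _ _).symm
      _ ≤ ((n + 1 - k) ^ 2) ^ k := Nat.pow_le_pow_left hsq k
      _ = ((n + 1 - k) ^ k) ^ 2 := by rw [← pow_mul, ← pow_mul, mul_comm]
      _ ≤ (k.factorial * n.choose k) ^ 2 := Nat.pow_le_pow_left hlow 2
      _ = k.factorial ^ 2 * (n.choose k) ^ 2 := mul_pow _ _ _
  exact Nat.lt_of_mul_lt_mul_left key

/-- The threshold is below `2^k`: `(n+2)^E < 2^((E+1)(⌊log₂(n+2)⌋+1))`. -/
theorem pow_lt_two_pow_succ_mul_log (n E : ℕ) :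
    (n + 2) ^ E < 2 ^ ((E + 1) * (Nat.log 2 (n + 2) + 1)) := by
  have h2 : n + 2 < 2 ^ (Nat.log 2 (n + 2) + 1) := Nat.lt_pow_succ_log_self (by norm_num) (n + 2)
  calc (n + 2) ^ E < (n + 2) ^ (E + 1) := Nat.pow_lt_pow_right (by omega) (by omega)
    _ < (2 ^ (Nat.log 2 (n + 2) + 1)) ^ (E + 1) := Nat.pow_lt_pow_left h2 (by omega)
    _ = 2 ^ ((E + 1) * (Nat.log 2 (n + 2) + 1)) := by rw [← pow_mul, mul_comm]

/-! ### The stub -/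

/-- The stub at fixed `c n D`, with the explicit order `k = (c⌊√n⌋+c+1)(⌊log₂(n+2)⌋+1)`:
if `2n < D` and `D · 4k ≤ n²` then `(n+2)^(c⌊√n⌋+c) · binom(D,k) < binom(n,k)²`. -/
theorem midGrowth_at (c n D : ℕ) (hD : 2 * n < D)
    (h : D * (4 * ((c * Nat.sqrt n + c + 1) * (Nat.log 2 (n + 2) + 1))) ≤ n ^ 2) :
    (n + 2) ^ (c * Nat.sqrt n + c) *
        D.choose ((c * Nat.sqrt n + c + 1) * (Nat.log 2 (n + 2) + 1)) <
      (n.choose ((c * Nat.sqrt n + c + 1) * (Nat.log 2 (n + 2) + 1))) ^ 2 := by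
  have hT := pow_lt_two_pow_succ_mul_log n (c * Nat.sqrt n + c)
  have hk1 : 1 ≤ (c * Nat.sqrt n + c + 1) * (Nat.log 2 (n + 2) + 1) :=
    Nat.mul_pos (Nat.succ_pos _) (Nat.succ_pos _)
  generalize (c * Nat.sqrt n + c + 1) * (Nat.log 2 (n + 2) + 1) = k at hT hk1 h ⊢
  refine mul_choose_lt_choose_sq n D k _ hk1 (by omega) hT ?_
  -- `8k < n`, from `8kn < 4kD ≤ n²`
  have h8 : 8 * k < n := by
    have h8n : 8 * k * n < n * n :=
      calc 8 * k * n = 4 * k * (2 * n) := by ring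
        _ < 4 * k * D := Nat.mul_lt_mul_of_pos_left hD (by omega)
        _ = D * (4 * k) := by ring
        _ ≤ n ^ 2 := h
        _ = n * n := sq n
    exact Nat.lt_of_mul_lt_mul_right h8n
  -- hence `7n < 8(n+1-k)` and `(n+1-k)² ≥ 49n²/64 ≥ 2kD`
  obtain ⟨w, hw⟩ : ∃ w : ℕ, w = n + 1 - k := ⟨_, rfl⟩
  rw [← hw]
  have hw7 : 7 * n < 8 * w := by omega
  have hsq : (7 * n) ^ 2 < (8 * w) ^ 2 := Nat.pow_lt_pow_left hw7 (by norm_num)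
  have hkD : 4 * (k * D) ≤ n ^ 2 := le_of_eq_of_le (by ring) h
  nlinarith [hsq, hkD]

/-- **Registered stub `stub_midGrowth`** (rev 2) of the birth line of crux `Depth3Thesis`
(stmt-ValiantsHypothesis-5934): the arithmetic of the extended flattening regime. For all `c n D`
with `2n < D` and `D · 4k ≤ n²`, `k := (c⌊√n⌋+c+1)(⌊log₂(n+2)⌋+1)`, some order `k'` (namely `k`)
has `(n+2)^(c⌊√n⌋+c) · binom(D,k') < binom(n,k')²`. -/
theorem stub_midGrowth :
    ∀ (c n D : ℕ), 2 * n < D →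
      D * (4 * ((c * Nat.sqrt n + c + 1) * (Nat.log 2 (n + 2) + 1))) ≤ n ^ 2 →
        ∃ k, (n + 2) ^ (c * Nat.sqrt n + c) * D.choose k < (n.choose k) ^ 2 :=
  fun c n D hD h => ⟨_, midGrowth_at c n D hD h⟩

end Summit.ValiantsHypothesis.ValiantsHypothesis.Theorems.SummationBitsDepth3Thesis
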